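import Summits.CriticalPhenomena.PercolationContinuityZ3.Theorems.Transplant.SkelPhiFaceRouteNumbersY5
import Summits.CriticalPhenomena.PercolationContinuityZ3.Theorems.Transplant.SkelPhiFaceRouteNums3
import Summits.CriticalPhenomena.PercolationContinuityZ3.Theorems.Transplant.SkelPhiFaceKitsG
import Summits.CriticalPhenomena.PercolationContinuityZ3.Theorems.Transplant.SkelPhiFaceTargetMM
import HarnessLib

/-!
# N1 ({±1} node), (F) inner route, part R5a-y4 (hp-8 g33): **THE ROUTE AT EVERY CENTRE OF A y′-FACE STEP FROM THE PER-CENTRE NUMBERS** —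
# the `hroute` input of `hkits_faceStepWNbG` (p299284) for the face step `faceStepWNb … a' x du j …` of the twin scheme, assembled from
# `faceRoute_of_numbers5_y` at every centre `c` of the `E`-enlarged level box inside `B(w₀, rE − r)`: habitat `Pl := farCore x du j k₀`
# (`hPlD` by `Win_subset_stepRgNb` + `farCore_spec`), target `targetMM` = `M_{a'}(x+du) ∪ RimG` (history-free; `⊆ T` by `targetMM_subset_T`, since the last core may sit beyond depth `rM − 1`), zone seed
# `Λc c kz` as the pinned seed (inside the region by the near-`c` reading), hop = the served long side half `hlongx σ c σ` (the along y′-run has sign `σ`, the tangential x-run sign `σ_T`), and the per-centre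
# data/inequalities read off `nums c : FaceRunNums … false c …` (R5a, p300269).  
builds on p205010 (kernel theorem, internal audit signed; external expert review pending) — nothing in this file uses p205010; no claim about the open node.
Lane `prim-bschramm`, seat `prim-hp-8` (gen 33); helper file (`--supports stmt-CriticalPhenomena-4575 --as helper`).
* **`Skelφ.hroute_of_faceRunNums_y4`** (target `targetMM` tested by a cell box, per-region readings: `FaceRunNums3` / `faceRoute_of_numbers5_y`).
[cite: KozmaNitzan2024, §4 Lemma 10 (pp. 17–21), Lemma 11 (pp. 22–23), Lemma 12 (pp. 23–25), p. 27 ((30))] [cite: MartineauTassion2017, §4.3 Lemma 4.2]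
-/

noncomputable section

open MeasureTheory ProbabilityTheory
open scoped ENNReal Classical

namespace Summit.CriticalPhenomena.PercolationContinuityZ3.Theorems.Transplant

open Literature.Probability.Percolation Literature.Probability.LatticeModels SimpleGraph GadgetSystem Contour KNCells
open Literature.Probability.Percolation.KozmaNitzan.Cells (oth sgOf stepVec_apply_fst)
open KNLevels ChainPlanar ChainPara
open Literature.Barriers.CriticalPhenomena (graphBall mem_graphBall_self graphBall_mono)
open BoxProdZ2 (ConcRadiiG)
open Skel (winGraph routeW excess)
open SkelI (tanOff)
open TwoAxis.Para (modulus detD)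

variable {V : Type} [DecidableEq V] {G : SimpleGraph V} [G.LocallyFinite]

namespace Skelφ

variable {φ : V → Site 2}

/-! ## The route at every centre of a y′-face step -/

/-- **THE ROUTE AT EVERY CENTRE OF A y′-FACE STEP FROM THE PER-CENTRE NUMBERS** (the `hroute` input of `hkits_faceStepWNbG`; see the
module docstring). [cite: KozmaNitzan2024, §4 Lemma 10 (pp. 17–21), Lemma 11 (pp. 22–23), Lemma 12 (pp. 23–25)] -/
theorem hroute_of_faceRunNums_y4 [Countable V] {types : Finset V} (hlipφ : Lip G φ) (hstep : Steps G φ) (hfr : Frames G φ types) (hκ : CylConn G φ types)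
    {Δg : ℕ} (hΔg : ∀ v, G.degree v ≤ Δg)
    -- the face frame and the face step of the twin scheme
    (pr : FinePrm) (w₀ : V) (du : MDir) (b : Fin 2) (hc₀ : 0 < pr.c₀) (hc₁ : 0 < pr.c₁) (hD : 0 < pr.D) (hL0 : pr.c₀ * pr.L 0 ≤ pr.D)
    (hL1 : pr.c₁ * pr.L 1 ≤ pr.D) (hA0 : 0 < pr.A) (hnz : pr.lvGen du.1 b ≠ 0) {nL : ℕ} (hnL : 1 ≤ nL) (hvL : |pr.vα| ≤ nL)
    (hmf : 0 ≤ modulus nL pr.h pr.vα pr.vβ)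
    (P : PCells2) (Λ : ConcRadiiG) (b₀ : Fin 2 → ℕ) (a' : ℕ) (x : Site 2) (j : ℕ) (pc : ℤ) (aw Rlev N M L' : ℕ) (Sfin : Finset V)
    {k₀ : ℤ} (hk₀ : pr.rdN du.1 b ≤ pr.rdK du.1 b * k₀) (hjK : j + 1 ≤ P.K) (hbpar : (b₀ du.1 : ℤ) + 2 ≤ 5 * P.r du.1)
    (hbperp : (b₀ (oth du.1) : ℤ) + k₀ + 3 ≤ 5 * P.r (oth du.1)) {E r : ℕ} (hrE : r ≤ Λ.rE a' x du)
    {Wt : Sym2 V → unitInterval} {q : unitInterval} (hWG : ∀ e, e ∉ G.edgeSet → Wt e = 0)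
    (hWD : IsSubbox (winGraph G w₀ (Λ.rE a' x du)) Wt q
      (stepRg G (pr.frame φ w₀ du.1 b) (faceStepWNb G pr φ P w₀ Λ b₀ b a' x du j pc aw Rlev N M L' Sfin)))
    {σ : ℤ} (hσ : σ = 1 ∨ σ = -1)
    (B : BridgePrm) (hB : BridgeOK B) {kq : ℕ} (hκL : pr.h.natAbs ≤ kq * nL) (ℓ' R's qB Rl R'₃ qB₃ : ℕ)
    (hlay : (nL + pr.h.natAbs : ℕ) ≤ (nL : ℤ) * ℓ' + 1)
    (Rlev₁ N₁ j₀₁ j₁₁ Rlev₂ N₂ j₀₂ j₁₂ Rlev₃ N₃' j₀₃ j₁₃ : ℕ) (hRl₁ : Rlev₁ + 1 ≤ B.R') (hRl₂ : Rlev₂ + 1 ≤ R's) (hRl₃ : Rlev₃ + 1 ≤ R'₃)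
    (hj₁ : j₁₁ ≤ Rlev₁) (hj₂ : j₁₂ ≤ Rlev₂) (hj₃ : j₁₃ ≤ Rlev₃)
    (hB0 : Finset.Icc (pt nL (σ * pr.h)) (pt nL (σ * pr.h + ℓ')) ⊆ Finset.Icc B.B₀lo B.B₀hi) (hRlr : Rl ≤ r)
    {sα sβ kpar kperp : ℤ} (hsab : ∀ x ∈ Finset.Icc B.regionLo B.regionHi, |x 0| ≤ sα ∧ |x 1| ≤ sβ)
    (hsQ : (nL : ℤ) ≤ sα ∧ 3 * (ℓ' : ℤ) + |pr.h| ≤ sβ) {Mz : ℕ} (hMzs : (Mz : ℤ) ≤ sα ∧ (Mz : ℤ) ≤ sβ)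
    (hnear₂ : ∀ c w, |φ w 0 - φ c 0| ≤ sα → |φ w 1 - φ c 1| ≤ sβ →
      |fineSkel φ c pr.A nL pr.h pr.vα pr.vβ pr.c₀ pr.c₁ (pr.D / 2) (pr.D / 2) pr.D w du.1| ≤ kpar ∧
        |fineSkel φ c pr.A nL pr.h pr.vα pr.vβ pr.c₀ pr.c₁ (pr.D / 2) (pr.D / 2) pr.D w (oth du.1)| ≤ kperp)
    {kb : ℕ} (hkbMz : (Mz : ℤ) ≤ kb) (hπ1 : (B.core1Lo 0).natAbs + (B.core1Lo 1).natAbs ≤ r) (hclr₁ : (kb : ℤ) < B.B₀lo 0 - B.R' - B.pr)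
    {Δ' : ℕ} {δ δK η : ℝ} (hδ : 0 < δ) (hδ1 : δ ≤ 1)
    (hchain : ∀ (c : V) (Nr N₃ : ℕ) (W : Sym2 V → unitInterval) (s : Fin (0 + 1 + Nr + 1 + N₃ + 1) → TStep (winGraph G c r))
      (T' : Fin (0 + 1 + Nr + 1 + N₃ + 1) → Finset V) (η : ℝ),
      (∀ i, (s i).L.o = (s 0).L.o) →
      (∀ i : Fin (0 + 1 + Nr + 1 + N₃), T' (Fin.castSucc i) ⊆ (s i.succ).L.X 0) →
      (∀ i, T' i ⊆ (s i).T) →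
      (∀ i, (s i).KitsAt W q Δ' δ) →
      η ≤ δ / 2 →
      (∀ i, (prodBernoulli W).real (⋃ t ∈ (s i).T \ T' i, openConn (s 0).L.o t) ≤ η) →
      1 - δ < (prodBernoulli W).real (s 0).L.reachB →
        1 - δK ^ 2 < (prodBernoulli W).real (⋃ t ∈ T' (Fin.last (0 + 1 + Nr + 1 + N₃)), openConn (s 0).L.o t))
    (hcount₁ : 1 / (1 - (q : ℝ)) ^ (Δ' * N₁) ≤ δ * ((Finset.Icc j₀₁ j₁₁).card : ℝ))
    (hcount₂ : 1 / (1 - (q : ℝ)) ^ (Δ' * N₂) ≤ δ * ((Finset.Icc j₀₂ j₁₂).card : ℝ))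
    (hcount₃ : 1 / (1 - (q : ℝ)) ^ (Δ' * N₃') ≤ δ * ((Finset.Icc j₀₃ j₁₃).card : ℝ))
    (hη : η ≤ δ / 2)
    (Pb Pr : ApronPrm) {Rs Kmaxb KCmaxb Kmaxr KCmaxr rsb rsr cSb cSr cU r₁ r₂ Rb : ℕ}
    (hPNb : 1 ≤ Pb.N) (hAb : Pb.A = (Mz : ℤ) + 2)
    (hd1b : Pb.W + Pb.ℓ ≤ Pb.d) (hD1b : Pb.W + Pb.ℓ + Pb.d + 2 ≤ shellD Pb) (hD2b : Pb.ℓ + Rs + Pb.d + 3 ≤ shellD Pb) (hDρb : Rs + 1 ≤ shellD Pb)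
    (hℓb : 1 ≤ Pb.ℓ) (hWb : Rs + Pb.ℓ ≤ Pb.W) (hKmaxb : shellD Pb + Pb.W ≤ Kmaxb) (hKCmaxb : shellD Pb + Mz + 1 ≤ KCmaxb)
    (hR'b : cylRadMax G φ types Pb.ℓ (Rs + KCmaxb + (Pb.W + Kmaxb)) ≤ Pb.R')
    (hwideb : ∀ j ≤ j₁₁, ∀ i, (B.B₀lo - (j : Site 2)) i + 2 * tanOff Pb.ℓs Pb.M ≤ (B.B₀hi + (j : Site 2)) i)
    (hdwb : ∀ j ≤ j₁₁, ∀ i, (B.B₀lo - (j : Site 2)) i + (Pb.d + 2 : ℕ) ≤ (B.B₀hi + (j : Site 2)) i)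
    (hDwb : ∀ j ≤ j₁₁, ∀ i, (B.B₀lo - (j : Site 2)) i + ((shellD Pb + 1 + Pb.d + KCmaxb + Rs : ℕ) : ℤ) ≤ (B.B₀hi + (j : Site 2)) i)
    (hTb : (Pb.W : ℤ) + Kmaxb + Pb.ℓ + 1 ≤ tanOff Pb.ℓs Pb.M) (hT'b : (shellD Pb : ℤ) + KCmaxb + Rs ≤ tanOff Pb.ℓs Pb.M)
    (hr₀b : Pb.N * (tanOff Pb.ℓs Pb.M + 2) + Pb.N * Pb.d + (Pb.W + Kmaxb + Pb.R') + (KCmaxb + Rs) ≤ Pb.r₀) (hRb₀ : Pb.r₀ ≤ r)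
    (hrsb : 2 * (1 + Pb.N * (tanOff Pb.ℓs Pb.M + 2) + Pb.N * Pb.d + (Pb.W + Kmaxb + Pb.R') + (KCmaxb + Rs)) ≤ rsb)
    (hcSb : (Pb.N + 1) * (tanOff Pb.ℓs Pb.M + 1) + (Pb.N + 1) * Pb.d + (2 * Pb.W + 1) * (Kmaxb + 1) * (Δg + 1) ^ Pb.R' ≤ cSb)
    (hEb : j₁₁ + (Pb.N * (tanOff Pb.ℓs Pb.M + 1) + Pb.N * Pb.d + KCmaxb) ≤ B.R')
    (hreachb : r₁ + (Pb.N * (tanOff Pb.ℓs Pb.M + 1) + Pb.N * Pb.d + KCmaxb) ≤ Pb.r₀) (hr₁ : Rb ≤ r₁) (hr₁R : r₁ ≤ r)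
    (hPNr : kq + 3 ≤ Pr.N) (hAr : Pr.A = (Mz + 1 : ℕ) * (shearUnit nL pr.h : ℤ) + 1)
    (hd1r : Pr.W + Pr.ℓ ≤ Pr.d) (hD1r : Pr.W + Pr.ℓ + Pr.d + 2 ≤ shellD Pr) (hD2r : Pr.ℓ + Rs + Pr.d + 3 ≤ shellD Pr) (hDρr : Rs + 1 ≤ shellD Pr)
    (hℓr : 1 ≤ Pr.ℓ) (hWr : Rs + Pr.ℓ ≤ Pr.W) (hKmaxr : (shellD Pr + Pr.W) * (kq + 1) ≤ Kmaxr) (hKCmaxr : (shellD Pr + Mz + 1) * (kq + 1) ≤ KCmaxr)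
    (hR'r : cylRadMax G φ types Pr.ℓ (Rs + KCmaxr + (Pr.W + Kmaxr)) ≤ Pr.R')
    (hwider : ∀ Nr, ∀ k ≤ Nr, ∀ j ≤ j₁₂, ∀ i, ((yRunSched hnL hvL hlay R's qB Nr).lo k - (j : Site 2)) i + 2 * tanOff Pr.ℓs Pr.M ≤
      ((yRunSched hnL hvL hlay R's qB Nr).hi k + (j : Site 2)) i)
    (hdwr : ∀ Nr, ∀ k ≤ Nr, ∀ j ≤ j₁₂, ∀ i, ((yRunSched hnL hvL hlay R's qB Nr).lo k - (j : Site 2)) i + (Pr.d + 2 : ℕ) ≤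
      ((yRunSched hnL hvL hlay R's qB Nr).hi k + (j : Site 2)) i)
    (hDwr : ∀ Nr, ∀ k ≤ Nr, ∀ j ≤ j₁₂, ∀ i, ((yRunSched hnL hvL hlay R's qB Nr).lo k - (j : Site 2)) i + ((shellD Pr + 1 + Pr.d + KCmaxr + Rs : ℕ) : ℤ) ≤
      ((yRunSched hnL hvL hlay R's qB Nr).hi k + (j : Site 2)) i)
    (hwidey : ∀ N₃, ∀ k ≤ N₃, ∀ j ≤ j₁₃, ∀ i, ((xRunSched nL ℓ' pr.h R'₃ qB₃ N₃).lo k - (j : Site 2)) i + 2 * tanOff Pr.ℓs Pr.M ≤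
      ((xRunSched nL ℓ' pr.h R'₃ qB₃ N₃).hi k + (j : Site 2)) i)
    (hdwy : ∀ N₃, ∀ k ≤ N₃, ∀ j ≤ j₁₃, ∀ i, ((xRunSched nL ℓ' pr.h R'₃ qB₃ N₃).lo k - (j : Site 2)) i + (Pr.d + 2 : ℕ) ≤
      ((xRunSched nL ℓ' pr.h R'₃ qB₃ N₃).hi k + (j : Site 2)) i)
    (hDwy : ∀ N₃, ∀ k ≤ N₃, ∀ j ≤ j₁₃, ∀ i, ((xRunSched nL ℓ' pr.h R'₃ qB₃ N₃).lo k - (j : Site 2)) i + ((shellD Pr + 1 + Pr.d + KCmaxr + Rs : ℕ) : ℤ) ≤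
      ((xRunSched nL ℓ' pr.h R'₃ qB₃ N₃).hi k + (j : Site 2)) i)
    (hTr : (Pr.W : ℤ) + Kmaxr + Pr.ℓ + 1 ≤ tanOff Pr.ℓs Pr.M) (hT'r : (shellD Pr : ℤ) + KCmaxr + Rs ≤ tanOff Pr.ℓs Pr.M)
    (hr₀r : Pr.N * (tanOff Pr.ℓs Pr.M + 2) + Pr.N * Pr.d + (Pr.W + Kmaxr + Pr.R') + (KCmaxr + Rs) ≤ Pr.r₀) (hRr₀ : Pr.r₀ ≤ r)
    (hrsr : 2 * (1 + Pr.N * (tanOff Pr.ℓs Pr.M + 2) + Pr.N * Pr.d + (Pr.W + Kmaxr + Pr.R') + (KCmaxr + Rs)) ≤ rsr)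
    (hcSr : (Pr.N + 1) * (tanOff Pr.ℓs Pr.M + 1) + (Pr.N + 1) * Pr.d + (2 * Pr.W + 1) * (Kmaxr + 1) * (Δg + 1) ^ Pr.R' ≤ cSr)
    (hEr : j₁₂ + (Pr.N * (tanOff Pr.ℓs Pr.M + 1) + Pr.N * Pr.d + KCmaxr) ≤ R's)
    (hEy : j₁₃ + (Pr.N * (tanOff Pr.ℓs Pr.M + 1) + Pr.N * Pr.d + KCmaxr) ≤ R'₃)
    (hreachr : r₂ + (Pr.N * (tanOff Pr.ℓs Pr.M + 1) + Pr.N * Pr.d + KCmaxr) ≤ Pr.r₀) (hr₂ : Rl ≤ r₂) (hr₂R : r₂ ≤ r)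
    (QK : ShortPcO V) (hRgRs : ∀ c', QK.RS c' ≤ Rs) (hRgcard : ∀ c', (RgO G φ QK c').card ≤ cU) (hcU1 : 1 ≤ cU)
    (hnSK : ∀ c', 22 * Mz + 58 ≤ QK.nS c') (hκSK : ∀ c', |QK.hS c'| ≤ 10 * (QK.nS c' : ℤ)) (hℓSK : ∀ c', 24 * Mz + 64 ≤ QK.ℓS c')
    (hκL10 : |pr.h| ≤ 10 * (nL : ℤ))
    (Λc : V → ℕ → Finset V) (kz : ℕ) (hkn : ∀ c', Λc c' kz ⊆ Λc c' Mz) (hΛ : ∀ c', ∀ v ∈ Λc c' Mz, v ∈ RgO G φ QK c' ∧ φ v - φ c' ∈ box 2 Mz)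
    (hZ : ∀ c', (↑(Λc c' Mz) : Set V) ⊆ cyl φ c' Mz) (hMz : Mz < nL) (hclrz : (Mz + 4) * (nL + pr.h.natAbs) ≤ nL * (ℓ' + 1))
    (hcz : ∀ c, c ∈ Λc c kz) (hzconn : ∀ c, ∀ s ∈ Λc c kz, PathIn G (↑(Λc c kz) : Set V) c s) (hRsr : Rs ≤ r)
    (hZU : ∀ c, Λc c kz ⊆ pgramPrismFin G φ c nL pr.h (3 * ℓ') Rl)
    (Qb Fb : V → Finset V)
    (hQb : ∀ c c', ∀ w ∈ Qb c', w ∈ graphBall G c' Rb ∧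
      rootFrame φ c σ w ∈ Finset.Icc (rootFrame φ c σ c' - ((B.pr : ℕ) : Site 2)) (rootFrame φ c σ c' + ((B.pr : ℕ) : Site 2)))
    (hFb : ∀ c c', ∀ w ∈ Fb c', w ∈ Qb c' ∧ rootFrame φ c σ w ∈ Finset.Icc (rootFrame φ c σ c' + B.dlo) (rootFrame φ c σ c' + B.dhi))
    (hFZ : ∀ c', Disjoint (Fb c') (Λc c' Mz))
    (kk₁ kk₂ kk₃ : ℕ) (hkN₁ : kk₁ * (Δg + 1) ^ (2 * rsb) ≤ N₁) (hkN₂ : kk₂ * (Δg + 1) ^ (2 * rsr) ≤ N₂) (hkN₃ : kk₃ * (Δg + 1) ^ (2 * rsr) ≤ N₃')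
    (hk₁ : (1 - (q : ℝ) ^ (1 + Δg * cSb + cSb * cU)) ^ kk₁ ≤ δ) (hk₂ : (1 - (q : ℝ) ^ (1 + Δg * cSr + cSr * cU)) ^ kk₂ ≤ δ)
    (hk₃ : (1 - (q : ℝ) ^ (1 + Δg * cSr + cSr * cU)) ^ kk₃ ≤ δ)
    (hzone : ∀ c', 1 - δ ^ 2 < (bondPercolation G q).real (UniqZone.zone G (Λc c') kz Mz))
    (hexitb : ∀ c' (i : Fin 2) (σ₀ : ℤˣ), 1 - δ ^ 2 < (bondPercolation G q).real
      (linkIn (↑(RgO G φ QK c') : Set V) (Λc c' kz) (pexRO G φ QK Mz Pb.A σ i σ₀ c')))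
    (hexitr : ∀ σT : ℤ, σT = 1 ∨ σT = -1 → ∀ c' (i : Fin 2) (σ₀ : ℤˣ), 1 - δ ^ 2 < (bondPercolation G q).real
      (linkIn (↑(RgO G φ QK c') : Set V) (Λc c' kz) (pexXO G φ QK Mz nL pr.h Pr.A σT i σ₀ c')))
    (hexity : ∀ c' (i : Fin 2) (σ₀ : ℤˣ), 1 - δ ^ 2 < (bondPercolation G q).real
      (linkIn (↑(RgO G φ QK c') : Set V) (Λc c' kz) (pexYO G φ QK Mz nL pr.h Pr.A σ i σ₀ c')))
    (hbridge : ∀ c', 1 - δ ^ 2 < (bondPercolation G q).real (linkIn (↑(Qb c') : Set V) (Λc c' kz) (Fb c')))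
    (hlongx : ∀ σ' : ℤ, σ' = 1 ∨ σ' = -1 → ∀ c' (τ : ℤ), τ = 1 ∨ τ = -1 → 1 - δ ^ 2 < (bondPercolation G q).real
      (linkIn (pgramPrism G φ c' nL pr.h (3 * ℓ') Rl) (Λc c' kz) (pgSideHalfW G φ c' nL pr.h ℓ' Rl σ' (σ' * τ))))
    (hlongy : ∀ c' (τ : ℤ), τ = 1 ∨ τ = -1 → 1 - δ ^ 2 < (bondPercolation G q).real
      (linkIn (pgramPrism G φ c' nL pr.h (3 * ℓ') Rl) (Λc c' kz) (pgTopPieceW G φ c' nL pr.h ℓ' Rl σ τ pr.vα)))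
    {R₁ : ℕ}
    (hR₁ : ∀ (c' : V) (R' : ℕ), R₁ ≤ R' → ∀ (Rw : ℕ) (D' B' : Finset V), (∀ d ∈ D', d ∈ graphBall G c' Rw) →
      (∀ d ∈ D', ∀ d' ∈ D', φ d - φ d' ∈ box 2 (2 * r)) → B' ⊆ D' → (∀ a ∈ B', a ∈ graphBall G c' Rs) →
        (bondPercolation G q).real (excess G c' R' D' B') ≤ η)
    (hR₁b : R₁ ≤ r - Pb.r₀) (hR₁r : R₁ ≤ r - Pr.r₀)
    -- THE PER-CENTRE NUMBERS
    (nums : ∀ c, pr.frame φ w₀ du.1 b c ∈ Finset.Icc (loN P x du j pc aw - ((E : ℕ) : Site 2)) (hiN P x du j pc aw + ((E : ℕ) : Site 2)) →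
      c ∈ graphBall G w₀ (Λ.rE a' x du - r) →
      FaceRunNums3 G φ (pr.ψ φ w₀) false c pr.A nL pr.h pr.vα pr.vβ pr.c₀ pr.c₁ pr.D du σ B ℓ' R's qB R'₃ qB₃ pr.vα hnL hvL hlay kb
        (P.farCore x du j k₀) (targetMM G φ pr P w₀ Λ b₀ a' x du L') (Λc c Mz) r kpar kperp) :
    ∀ c, pr.frame φ w₀ du.1 b c ∈ Finset.Icc (loN P x du j pc aw - ((E : ℕ) : Site 2)) (hiN P x du j pc aw + ((E : ℕ) : Site 2)) →
      c ∈ graphBall G w₀ (Λ.rE a' x du - r) →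
      ∃ Qt Ft : Finset V, Ft ⊆ (faceStepWNb G pr φ P w₀ Λ b₀ b a' x du j pc aw Rlev N M L' Sfin).T ∧
        Qt ⊆ stepRg G (pr.frame φ w₀ du.1 b) (faceStepWNb G pr φ P w₀ Λ b₀ b a' x du j pc aw Rlev N M L' Sfin) ∧ Disjoint Ft (Λc c Mz) ∧
        1 - δK ^ 2 < (prodBernoulli Wt).real (linkIn (↑Qt : Set V) (Λc c kz) Ft) := by
  intro c hc1 hc2
  set Q := faceStepWNb G pr φ P w₀ Λ b₀ b a' x du j pc aw Rlev N M L' Sfin with hQ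
  obtain 𝓝 := nums c hc1 hc2
  have hLI : pr.cOf du.1 * pr.L du.1 ≤ pr.D := pr.cOf_mul_L_le hL0 hL1 du.1
  have hlipF : Lip G (pr.frame φ w₀ du.1 b) := pr.lip_frame hlipφ w₀ du.1 b (pr.cOf_pos hc₀ hc₁ du.1).le hD hLI
  have hRg : ∀ c', ∀ u ∈ RgO G φ QK c', u ∈ graphBall G c' Rs := fun c' u hu =>
    graphBall_mono G c' (hRgRs c') (RgO_subset_graphBall QK c' u hu)
  -- the habitat lies in the region, the target in `T`, the region in the outer ball
  have hPlD : Win G (pr.ψ φ w₀) w₀ (P.farCore x du j k₀) (Λ.rE a' x du) ⊆ stepRg G (pr.frame φ w₀ du.1 b) Q :=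
    Win_subset_stepRgNb G φ P w₀ Λ b₀ a' pc aw Rlev N M L' Sfin hlipF hc₀ hc₁ hD hnz hk₀ P.farCore_spec le_rfl
  have hMT : targetMM G φ pr P w₀ Λ b₀ a' x du L' ⊆ Q.T :=
    targetMM_subset_T (Win_subset_stepRgNb G φ P w₀ Λ b₀ a' pc aw Rlev N M L' Sfin hlipF hc₀ hc₁ hD hnz hk₀ (P.Mb_thick_mem_farAS₂ hjK hbpar hbperp)
      le_rfl)
  have hDπ : ∀ u ∈ stepRg G (pr.frame φ w₀ du.1 b) Q, u ∈ graphBall G w₀ (Λ.rE a' x du) := fun u hu =>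
    ((mem_Win G _).1 (stepRgNb_subset_Win G pr φ P w₀ Λ b₀ b a' x du j pc aw Rlev N M L' Sfin hu)).1
  -- the near-`c` footprint reading
  have hnear : ∀ w, |φ w 0 - φ c 0| ≤ sα → |φ w 1 - φ c 1| ≤ sβ →
      FootBox 𝓝.flo 𝓝.fhi 𝓝.fw du (fineSkel φ c pr.A nL pr.h pr.vα pr.vβ pr.c₀ pr.c₁ (pr.D / 2) (pr.D / 2) pr.D w) := fun w h0 h1 =>
    footBox_of_abs_le (hnear₂ c w h0 h1).1 (hnear₂ c w h0 h1).2 𝓝.hfR.1 𝓝.hfR.2.1 𝓝.hfR.2.2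
  -- the zone seed: inside the short region, the long prism, the face-step region
  have hZball : ∀ s ∈ Λc c kz, s ∈ graphBall G c Rs := fun s hs => hRg c s (hΛ c s (hkn c hs)).1
  have hZbox : ∀ s ∈ Λc c kz, |φ s 0 - φ c 0| ≤ Mz ∧ |φ s 1 - φ c 1| ≤ Mz := fun s hs => by
    have hb := (hΛ c s (hkn c hs)).2
    rw [mem_box] at hb
    have h0 := hb 0; have h1 := hb 1
    simp only [Pi.sub_apply] at h0 h1
    exact ⟨abs_le.2 ⟨h0.1, h0.2⟩, abs_le.2 ⟨h1.1, h1.2⟩⟩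
  have hSφ : ∀ s ∈ Λc c kz, |φ s 0 - φ c 0| ≤ kb := fun s hs => (hZbox s hs).1.trans hkbMz
  have hball : ∀ {w : V}, w ∈ graphBall G c r → w ∈ graphBall G w₀ (Λ.rE a' x du) := by
    intro w hw
    have h2 := BoxProdZ2.mem_graphBall_add G hc2 hw
    rwa [Nat.sub_add_cancel hrE] at h2
  have hSD : Λc c kz ⊆ stepRg G (pr.frame φ w₀ du.1 b) Q := fun s hs => by
    obtain ⟨h0, h1⟩ := hZbox s hs
    have hsr : s ∈ graphBall G c r := graphBall_mono G c hRsr (hZball s hs)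
    exact hPlD ((mem_Win G _).2 ⟨hball hsr, 𝓝.hPlfoot s hsr (hnear s (h0.trans hMzs.1) (h1.trans hMzs.2))⟩)
  -- the hop: the served long side half at `c`, seeded by the zone seed
  have hσsq : σ * σ = 1 := by rcases hσ with rfl | rfl <;> norm_num
  have hlink : 1 - δ < (bondPercolation G q).real
      (linkIn (↑(pgramPrismFin G φ c nL pr.h (3 * ℓ') Rl) : Set V) (Λc c kz) (pgSideHalfW G φ c nL pr.h ℓ' Rl σ 1)) := by
    have hcoe : (↑(pgramPrismFin G φ c nL pr.h (3 * ℓ') Rl) : Set V) = pgramPrism G φ c nL pr.h (3 * ℓ') Rl := by ext w; simp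
    have h1 := hlongx σ hσ c σ hσ
    rw [hσsq] at h1
    rw [hcoe]
    have hδ2 : δ ^ 2 ≤ δ := by nlinarith
    linarith
  exact faceRoute_of_numbers5_y hlipφ hstep hfr hκ hΔg hWG hWD hDπ hc2 hrE hPlD hMT 𝓝.hMZ du hσ hA0.le hnL pr.h hmf hc₀.le hc₁.le hD
    𝓝.hPlfoot 𝓝.hMfoot (hcz c) (hzconn c) hSD hZball hRsr hSφ B hB hκL ℓ' R's qB 𝓝.Nr Rl 𝓝.hσT hvL hlay R'₃ qB₃ 𝓝.N₃ 𝓝.cL 𝓝.cT 𝓝.hcLφ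
    𝓝.hcTφ 𝓝.hcLπ 𝓝.hcTπ Rlev₁ N₁ j₀₁ j₁₁ Rlev₂ N₂ j₀₂ j₁₂ Rlev₃ N₃' j₀₃ j₁₃ hRl₁ hRl₂ hRl₃ hj₁ hj₂ hj₃ hB0 hRlr hsab hsQ hnear 𝓝.hreg 𝓝.hP0
    𝓝.hP1 𝓝.hP2 𝓝.hP3 𝓝.hPf₁ 𝓝.hPf₂ 𝓝.hPf₃ 𝓝.hregY 𝓝.hlastc 𝓝.hY0 𝓝.hY1 𝓝.hY2 𝓝.hY3 𝓝.hYf₁ 𝓝.hYf₂ 𝓝.hYf₃ 𝓝.hL0 𝓝.hL1 𝓝.hL2 𝓝.hL3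
    (𝓝.hxaY rfl) (𝓝.hxbY rfl) (𝓝.hxyY rfl) 𝓝.hclr hclr₁ 𝓝.hclr₃ hπ1 (𝓝.hπ2Y rfl) (𝓝.hπ3Y rfl) subset_rfl (hZU c) hδ
    hlink (hchain c 𝓝.Nr 𝓝.N₃) hcount₁ hcount₂ hcount₃ hη Pb Pr hPNb hAb hd1b hD1b hD2b hDρb hℓb hWb hKmaxb hKCmaxb hR'b hwideb hdwb hDwb hTb
    hT'b hr₀b hRb₀ hrsb hcSb hEb hreachb hr₁ hr₁R hPNr hAr hd1r hD1r hD2r hDρr hℓr hWr hKmaxr hKCmaxr hR'r (hwider 𝓝.Nr) (hdwr 𝓝.Nr) (hDwr 𝓝.Nr)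
    (hwidey 𝓝.N₃) (hdwy 𝓝.N₃) (hDwy 𝓝.N₃) hTr hT'r hr₀r hRr₀ hrsr hcSr hEr hEy hreachr hr₂ hr₂R QK hRgRs hRgcard hcU1 hnSK hκSK hℓSK hκL10 Λc kz
    hkn hΛ hZ hMz hclrz Qb Fb (hQb c) (hFb c) hFZ kk₁ kk₂ kk₃ hkN₁ hkN₂ hkN₃ hk₁ hk₂ hk₃ hzone hexitb (hexitr 𝓝.σT 𝓝.hσT) hexity hbridge (hlongx 𝓝.σT 𝓝.hσT)
    hlongy hR₁ hR₁b hR₁r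

end Skelφ

end Summit.CriticalPhenomena.PercolationContinuityZ3.Theorems.Transplant

end
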